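import Literature.MathematicalPhysics.QuantumFieldTheory.Balaban1983to89.B11Eq118RegimeRadii
import Literature.MathematicalPhysics.QuantumFieldTheory.Balaban1983to89.B11Eq44COperatorTorus

/-!
# `Balaban1983to89.B11Eq118RegimeRadiiUniform` — T. Bałaban, *The variational problem and background fields in renormalization group method for
# lattice gauge theories*, Commun. Math. Phys. **102** (1985) 277–309 [Balaban1985Variational] Prop. 6 (117)–(121) p. 295, Prop. 3 p. 289 with (46)
# p. 285 and Sect. C (62) p. 287: THE SMALLNESS LETTERS DEPEND ON THE OPERATORS ONLY THROUGH THEIR BOUNDS — ONE choice of radii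
# `j, a, ε₄, a_C, ε_C, R′, R_b` (CLOSED-FORM in `B₀, b, b₁, C₄, a₃, C₂, c₄`) serves EVERY family of operators `𝒢, H, H₁` obeying `‖𝒢f‖ ≤ B₀‖f‖`,
# `‖Hf‖ ≤ b‖f‖`, `‖H₁B‖ ≤ b₁‖B‖`; at the pub-balaban NE9 letters: the Sect. C regime of (47) at `(H, Cc …)` with the SAME `(a_C, ε_C)` for every
# background `U` of the (31)–(32)-window and every carrier-typed `H` under one (46)-type bound `b`

statement-level skeleton of published theorems with citation tags; proofs where landed; nothing here is a claim about the Yang–Mills mass gap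

PDF held: `paper:balaban1985-cmp102-variational-background` (journal page = PDF page + 276), pp. 282, 285, 287, 289, 295; read by this seat (2026-08-22;
p. 289 L18–20, p. 285 L16–17, p. 287 L17 (62), p. 282 L32–34 (31)–(32) first-hand on the text layer).

THE PRINT (verbatim).  p. 289, Prop. 3: *«The transformation (47) satisfying the identity (48), i.e. linearizing the averaging operation Q(LʲηA′),
is defined and analytic for A′ satisfying (43) with ε₃ sufficiently small (e.g. 18C₂B₀dc₁(½)ε₃ ≤ 1, 2ε₃ ≤ c₄).»*; p. 285: *«and the Theorem 3.12
from [5] implies |HB| ≤ B₀(Lʲη)⁻¹|B|, |∇HB| ≤ B₀(Lʲη)⁻²|B| on Ω_j. (46)»*; p. 295, Prop. 6 (p0019 L32–33): *«There exists a positive, absolute constant a₄ such, that for ε₄ ≤ a₄ and ε₁ satisfying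
2B₀C₁B₃ε₁ ≤ ε₄ Eq. (111) has exactly one solution in the space (115).»*  In print the smallness thresholds are FORMULAS in the constants `B₀, C₂, C₄, …`
(which print proves uniform); the operators enter only through those constants.

WHY THIS FILE (cell context).  The owner's `B11Eq118RegimeRadii.exists_regime_radii` ∕ `exists_twoRegimes_radii` choose the radii of ONE regime
from the operator norms `‖𝒢‖`, `‖H‖`, `‖H₁‖` of GIVEN maps — per lattice AND per background.  The NE9 chain's next statements quantify over the
small-field set of a fixed lattice (`B9Thm311SmallFieldGreen`: `γ₁, ε₃` before `∀ U`; the owner's (H2)∕(H3) programme: bounds of `H₁(U)`, `𝔊(U)`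
uniform over that set; the desk's T24).  To turn «∀ U, ∃ radii» into «∃ radii, ∀ U» one needs the radii as functions of BOUNDS, not of the
operators — and, since the NE9 carriers `Space115 … (nabla115 η U)` DEPEND on `U`, as CLOSED-FORM expressions rather than an `∃` per type.  This file
supplies exactly that, and instantiates it at the Sect. C letter `Cc` whose `Prop4Hyp` constants (`C₂ = 2097152(d+1)²`, `c₄ = 1∕(512(d+1))`,
NE9 leaf-03's `prop4Hyp_Cc`) are ALREADY uniform in `U`.

WHAT IS PROVED (sorry-free; real arithmetic + operator bounds; no `Prop` placeholder; no inequality of the paper asserted).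
* §1 `Regime.of_normBound_zeroLinear` (a regime at a BOUND `B₀` of `𝒢`, from the three scalar conditions), `Regime.swap` (a regime is blind to
  which operator obeys the bound); **`regime_explicit`** — with the CLOSED-FORM radius `r(B₀, C₄, a₃, δ) := min (a₃∕4) (min (δ∕2) (1∕(16(B₀C₄+1))))`
  written out: for EVERY `𝒢` with `‖𝒢f‖ ≤ B₀‖f‖`, EVERY `W` quadratic-analytic with `(C₄, a₃)` and every `0 ≤ j ≤ r∕(4(B₀+1))`,
  `Regime 𝒢 0 W B₀ 0 C₄ a₃ j r r`; `radius_pos`, `radius_add_le` (`r + r ≤ δ`), `radius_contr` (`4B₀C₄(r + r) < 1`); the `∃`-form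
  **`exists_regime_radii_uniform`** (radii BEFORE `𝒢` and `W`; at `B₀ := ‖𝒢‖` it specialises to the owner's `exists_regime_radii`, not restated).
* §2 **`exists_twoRegimes_radii_uniform`** — ONE set `j a ε₄ a_C ε_C R′ R_b > 0` (with `ε₄ + a ≤ a_C`, `(ε₄+a)∕(1 − 4bC₂(ε_C+a_C)) ≤ R′`,
  `4bC₂(ε_C+a_C) < 1`) serving EVERY `(𝒢, H, H₁)` under the bounds `(B₀, b, b₁)` and EVERY `W`, `C` with the given constants: both regimes and
  the datum ball `‖H₁B‖ < a` on `‖B‖ < R_b` — the owner's `exists_twoRegimes_radii` with the quantifiers COMMUTED.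
* §3 AT THE NE9 LETTERS — **`sectC_regime_uniform`**: for every background `U` in the (31)–(32)-window (`1 ≤ L`, `α ≤ 1∕128`, `hU1`, `hreg`, `1 ≤ lev₀`) and
  EVERY carrier-typed `H : |·|_{(−0)} → (115)_U` with `‖Hf‖ ≤ b‖f‖`: `Regime H 0 (Cc L m η U …) b 0 (2097152(d+1)²) (1∕(512(d+1))) 0 r_C r_C` at the SAME
  closed-form `r_C(b, d) := min (c₄∕4) (min (1∕2) (1∕(16(bC₂+1))))` — the Sect. C radii UNIFORM over the small-field set GIVEN a uniform (46)-bound `b`;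
  `sectC_regime_uniform_opNorm` (at `b := B` from `‖H‖ ≤ B`).
MODEL / DECLARED READINGS.  (M1) abstract complex normed spaces as in `B11Eq174Chart`; §3 on the NE9 carriers.  (M2) displayed: the bounds `B₀, b, b₁`
(print's (46)∕(117)∕(103) constants — NOT proved uniform here: that is [5] Thms 3.12∕3.13, the owner's (H3)), the (31)–(32)-window letters.  (M3) closed-form
but crude radii (halving caps); NOT print's thresholds `18C₂B₀dc₁(½)ε₃ ≤ 1` etc. verbatim.
HONEST SCOPE.  [folklore] real arithmetic + quantifier bookkeeping over the cell's own `Regime` structure; the uniformity PROVED here is «radii depend on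
bounds only» — the bounds themselves stay letters; NOT summit progress (cell pub-balaban: NE9 NOT PRINTED ∕ NOT PROVED; spine PROVED 0∕9; rung (B)+1 finite
torus; NOT infinite volume, NOT mass gap, NOT Clay).  Filed by the pub-balaban NE9 crux-team leaf lineage `b2b-balaban-t4-ne9-formalise-leaf-01` (gen 74);
NEW file importing the owner's `B11Eq118RegimeRadii` and NE9 leaf-03's `B11Eq44COperatorTorus`; nothing modified.  Net new unproved facts: 0.
-/

noncomputable section

namespace Literature.MathematicalPhysics.QuantumFieldTheory.Balaban1983to89.B11Eq118RegimeRadiiUniform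

open Metric Set
open B13Contraction113 (QuadAnalytic)
open B11Eq174Chart (Regime)

/-! ## §1 One regime: radii from a BOUND, in closed form -/

section One

variable {𝒴 𝒵 : Type*} [NormedAddCommGroup 𝒴] [NormedSpace ℂ 𝒴] [NormedAddCommGroup 𝒵] [NormedSpace ℂ 𝒵]

/-- **A regime at a BOUND `B₀` of the operator** (not its norm): `‖𝒢f‖ ≤ B₀‖f‖` and the three scalar conditions at `B₀` (θ = 0, no linear term,
as in (116)∕(175)). [cite: Balaban1985Variational, Prop. 6 (117)–(121) p.295] -/
theorem Regime.of_normBound_zeroLinear (𝒢 : 𝒵 →L[ℂ] 𝒴) {B₀ : ℝ} (hB₀ : 0 ≤ B₀) (h𝒢 : ∀ f, ‖𝒢 f‖ ≤ B₀ * ‖f‖)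
    {W : 𝒴 → 𝒵} {C₄ a₃ j a ε₄ : ℝ} (hW : QuadAnalytic W C₄ a₃) (hC₄ : 0 ≤ C₄)
    (hε₄ : 0 ≤ ε₄) (hdom : 2 * (ε₄ + a) ≤ a₃) (hself : B₀ * j + B₀ * C₄ * (ε₄ + a) ^ 2 ≤ ε₄) (hcontr : 4 * B₀ * C₄ * (ε₄ + a) < 1) :
    Regime 𝒢 0 W B₀ 0 C₄ a₃ j a ε₄ :=
  ⟨h𝒢, fun Y => by simp, hW, hB₀, hC₄, le_rfl, hε₄, hdom, by simpa using hself, by simpa using hcontr⟩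

/-- **A regime is blind to WHICH operator obeys the bound**: `Regime 𝒢 …` with constant `B₀` transfers to any `𝒢′` with `‖𝒢′f‖ ≤ B₀‖f‖` — the
operator enters (118)∕(121) only through `B₀`. [cite: Balaban1985Variational, Prop. 6 (117)–(121) p.295] -/
theorem Regime.swap {𝒢 𝒢' : 𝒵 →L[ℂ] 𝒴} {Λ : 𝒴 →L[ℂ] 𝒴} {W : 𝒴 → 𝒵} {B₀ θ C₄ a₃ j a ε₄ : ℝ}
    (R : Regime 𝒢 Λ W B₀ θ C₄ a₃ j a ε₄) (h𝒢' : ∀ f, ‖𝒢' f‖ ≤ B₀ * ‖f‖) : Regime 𝒢' Λ W B₀ θ C₄ a₃ j a ε₄ :=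
  ⟨h𝒢', R.norm_L, R.quad, R.B₀_nonneg, R.C₄_nonneg, R.θ_nonneg, R.ε₄_nonneg, R.dom, R.self, R.contr⟩

/-- The closed-form radius is positive. [cite: Balaban1985Variational, Prop. 6 (118) p.295] -/
theorem radius_pos {B₀ C₄ a₃ δ : ℝ} (hB₀ : 0 ≤ B₀) (hC₄ : 0 ≤ C₄) (ha₃ : 0 < a₃) (hδ : 0 < δ) :
    0 < min (a₃ / 4) (min (δ / 2) (1 / (16 * (B₀ * C₄ + 1)))) := by
  have hK : 0 < B₀ * C₄ + 1 := by positivity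
  exact lt_min (by positivity) (lt_min (by positivity) (by positivity))

/-- The closed-form radius respects the cap: `r + r ≤ δ`. [cite: Balaban1985Variational, (62) p.287] -/
theorem radius_add_le {B₀ C₄ a₃ δ : ℝ} :
    min (a₃ / 4) (min (δ / 2) (1 / (16 * (B₀ * C₄ + 1)))) + min (a₃ / 4) (min (δ / 2) (1 / (16 * (B₀ * C₄ + 1)))) ≤ δ := by
  have h : min (a₃ / 4) (min (δ / 2) (1 / (16 * (B₀ * C₄ + 1)))) ≤ δ / 2 := (min_le_right _ _).trans (min_le_left _ _)
  linarith

/-- The closed-form radius makes the map contractive: `4B₀C₄(r + r) < 1` ((121), second member). [cite: Balaban1985Variational, Prop. 6 (121) p.295] -/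
theorem radius_contr {B₀ C₄ a₃ δ : ℝ} (hB₀ : 0 ≤ B₀) (hC₄ : 0 ≤ C₄) (ha₃ : 0 < a₃) (hδ : 0 < δ) :
    4 * B₀ * C₄ * (min (a₃ / 4) (min (δ / 2) (1 / (16 * (B₀ * C₄ + 1)))) + min (a₃ / 4) (min (δ / 2) (1 / (16 * (B₀ * C₄ + 1))))) < 1 := by
  set ε₄ : ℝ := min (a₃ / 4) (min (δ / 2) (1 / (16 * (B₀ * C₄ + 1)))) with hε₄def
  have hK : 0 < B₀ * C₄ + 1 := by positivity
  have hε₄0 : 0 < ε₄ := radius_pos hB₀ hC₄ ha₃ hδ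
  have hε₄K : ε₄ ≤ 1 / (16 * (B₀ * C₄ + 1)) := (min_le_right _ _).trans (min_le_right _ _)
  have h1 : 16 * (B₀ * C₄ + 1) * ε₄ ≤ 1 := by rw [le_div_iff₀ (by positivity)] at hε₄K; linarith
  nlinarith [mul_nonneg hB₀ hC₄]

/-- **ONE REGIME AT CLOSED-FORM RADII, FOR EVERY OPERATOR UNDER THE BOUND**: with `r := min (a₃∕4) (min (δ∕2) (1∕(16(B₀C₄+1))))` — a formula in
`B₀, C₄, a₃, δ` alone — EVERY `𝒢` with `‖𝒢f‖ ≤ B₀‖f‖` and EVERY `W` quadratic-analytic with `(C₄, a₃)` satisfy `Regime 𝒢 0 W B₀ 0 C₄ a₃ j r r` for every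
current letter `j ≤ r∕(4(B₀+1))` — print's «for ε₁ sufficiently small» with the threshold depending on the constants only.
[cite: Balaban1985Variational, Prop. 6 (118), (121) p.295] -/
theorem regime_explicit {B₀ C₄ a₃ δ : ℝ} (hB₀ : 0 ≤ B₀) (hC₄ : 0 ≤ C₄) (ha₃ : 0 < a₃) (hδ : 0 < δ)
    (𝒢 : 𝒵 →L[ℂ] 𝒴) (h𝒢 : ∀ f, ‖𝒢 f‖ ≤ B₀ * ‖f‖) {W : 𝒴 → 𝒵} (hW : QuadAnalytic W C₄ a₃)
    {j : ℝ} (hj : j ≤ min (a₃ / 4) (min (δ / 2) (1 / (16 * (B₀ * C₄ + 1)))) / (4 * (B₀ + 1))) :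
    Regime 𝒢 0 W B₀ 0 C₄ a₃ j (min (a₃ / 4) (min (δ / 2) (1 / (16 * (B₀ * C₄ + 1)))))
      (min (a₃ / 4) (min (δ / 2) (1 / (16 * (B₀ * C₄ + 1))))) := by
  set ε₄ : ℝ := min (a₃ / 4) (min (δ / 2) (1 / (16 * (B₀ * C₄ + 1)))) with hε₄def
  have hK : 0 < B₀ * C₄ + 1 := by positivity
  have hε₄0 : 0 < ε₄ := radius_pos hB₀ hC₄ ha₃ hδ
  have hε₄a : ε₄ ≤ a₃ / 4 := min_le_left _ _
  have hε₄K : ε₄ ≤ 1 / (16 * (B₀ * C₄ + 1)) := (min_le_right _ _).trans (min_le_right _ _)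
  have hprod : 16 * (B₀ * C₄) * ε₄ ≤ 1 := by
    have h1 : 16 * (B₀ * C₄ + 1) * ε₄ ≤ 1 := by rw [le_div_iff₀ (by positivity)] at hε₄K; linarith
    nlinarith
  refine Regime.of_normBound_zeroLinear 𝒢 hB₀ h𝒢 hW hC₄ hε₄0.le (by linarith) ?_ ?_
  · -- (118): `B₀ j + B₀C₄(2ε₄)² ≤ ε₄/4 + ε₄/4 ≤ ε₄`
    have h1 : B₀ * j ≤ ε₄ / 4 := by
      have : B₀ * j ≤ B₀ * (ε₄ / (4 * (B₀ + 1))) := mul_le_mul_of_nonneg_left hj hB₀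
      refine this.trans ?_
      rw [mul_div_assoc', div_le_div_iff₀ (by positivity) (by positivity)]
      nlinarith
    have h2 : B₀ * C₄ * (ε₄ + ε₄) ^ 2 ≤ ε₄ / 4 := by nlinarith
    linarith
  · -- (121) second member
    nlinarith

/-- **UNIFORM RADII (∃-form)**: given only `B₀ ≥ 0`, `C₄ ≥ 0`, `a₃ > 0` and a cap `δ > 0`, radii `j₀, a, ε₄ > 0` with `ε₄ + a ≤ δ` such that EVERY
`𝒢` with `‖𝒢f‖ ≤ B₀‖f‖` and EVERY `W` quadratic-analytic with `(C₄, a₃)` are in the regime for every `0 ≤ j ≤ j₀` — the owner's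
`exists_regime_radii` with the quantifiers COMMUTED (radii BEFORE the operator and the functional). [cite: Balaban1985Variational, Prop. 6 (118), (121) p.295] -/
theorem exists_regime_radii_uniform {B₀ C₄ a₃ δ : ℝ} (hB₀ : 0 ≤ B₀) (hC₄ : 0 ≤ C₄) (ha₃ : 0 < a₃) (hδ : 0 < δ) :
    ∃ j₀ a ε₄ : ℝ, 0 < j₀ ∧ 0 < a ∧ 0 < ε₄ ∧ ε₄ + a ≤ δ ∧
      ∀ (𝒢 : 𝒵 →L[ℂ] 𝒴), (∀ f, ‖𝒢 f‖ ≤ B₀ * ‖f‖) → ∀ {W : 𝒴 → 𝒵}, QuadAnalytic W C₄ a₃ →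
        ∀ j, 0 ≤ j → j ≤ j₀ → Regime 𝒢 0 W B₀ 0 C₄ a₃ j a ε₄ :=
  ⟨_, _, _, by have := radius_pos hB₀ hC₄ ha₃ hδ; positivity, radius_pos hB₀ hC₄ ha₃ hδ, radius_pos hB₀ hC₄ ha₃ hδ, radius_add_le,
    fun 𝒢 h𝒢 _ hW _ _ hj => regime_explicit hB₀ hC₄ ha₃ hδ 𝒢 h𝒢 hW hj⟩

/- (At `B₀ := ‖𝒢‖`, `h𝒢 := 𝒢.le_opNorm`, `exists_regime_radii_uniform` gives back the owner's `B11Eq118RegimeRadii.exists_regime_radii`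
   statement — not restated here (dedup); use that declaration.) -/

end One

/-! ## §2 The composite chart's scalar letters: ONE choice for every triple under the bounds -/

section Two

variable {𝒴 𝒵 𝒳 ℬ : Type*} [NormedAddCommGroup 𝒴] [NormedSpace ℂ 𝒴] [NormedAddCommGroup 𝒵] [NormedSpace ℂ 𝒵]
  [NormedAddCommGroup 𝒳] [NormedSpace ℂ 𝒳] [NormedAddCommGroup ℬ] [NormedSpace ℂ ℬ]

/-- **UNIFORM JOINT CHOICE OF ALL SCALAR LETTERS OF THE COMPOSITE CHART (174)∘(47)**: given only bounds `B₀, b, b₁ ≥ 0` and the constants `(C₄, a₃)`,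
`(C₂, c₄)`, there is ONE set of radii `j a ε₄ a_C ε_C R′ R_b > 0` with `ε₄ + a ≤ a_C` («ε₂ ≤ ¼ε₃», (62)), `(ε₄ + a)∕(1 − 4bC₂(ε_C + a_C)) ≤ R′` and
`4bC₂(ε_C + a_C) < 1`, such that EVERY triple `(𝒢, H, H₁)` with `‖𝒢f‖ ≤ B₀‖f‖`, `‖Hf‖ ≤ b‖f‖`, `‖H₁B‖ ≤ b₁‖B‖` and EVERY `W`, `C` quadratic-analytic
with those constants satisfy the Sect. E∕G regime, the Sect. C regime and the datum-ball letter `‖H₁B‖ < a` on `‖B‖ < R_b` ((172)) — letter for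
letter the scalar hypotheses of `NE9B11ChartAnalytic.chartHB_triple_of_twoRegimes`, now chosen ONCE for a whole family of backgrounds.
[cite: Balaban1985Variational, Prop. 6 (117)–(121) p.295, (62) p.287, (172) p.305] -/
theorem exists_twoRegimes_radii_uniform {B₀ b b₁ C₄ a₃ C₂ c₄ : ℝ} (hB₀ : 0 ≤ B₀) (hb : 0 ≤ b) (hb₁ : 0 ≤ b₁)
    (hC₄ : 0 ≤ C₄) (ha₃ : 0 < a₃) (hC₂ : 0 ≤ C₂) (hc₄ : 0 < c₄) :
    ∃ j a ε₄ aC εC R' Rb : ℝ, 0 < j ∧ 0 < a ∧ 0 < ε₄ ∧ 0 < aC ∧ 0 < εC ∧ 0 < R' ∧ 0 < Rb ∧ ε₄ + a ≤ aC ∧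
      1 / (1 - 4 * b * C₂ * (εC + aC)) * (ε₄ + a) ≤ R' ∧ 4 * b * C₂ * (εC + aC) < 1 ∧
      ∀ (𝒢 : 𝒵 →L[ℂ] 𝒴) (H : 𝒳 →L[ℂ] 𝒴) (H₁ : ℬ →L[ℂ] 𝒴), (∀ f, ‖𝒢 f‖ ≤ B₀ * ‖f‖) → (∀ f, ‖H f‖ ≤ b * ‖f‖) →
        (∀ B, ‖H₁ B‖ ≤ b₁ * ‖B‖) → ∀ {W : 𝒴 → 𝒵} {C : 𝒴 → 𝒳}, QuadAnalytic W C₄ a₃ → QuadAnalytic C C₂ c₄ →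
        Regime 𝒢 0 W B₀ 0 C₄ a₃ j a ε₄ ∧ Regime H 0 C b 0 C₂ c₄ 0 aC εC ∧ ∀ B ∈ ball (0 : ℬ) Rb, ‖H₁ B‖ < a := by
  -- Sect. C radii first (cap 1), then Sect. E/G radii under the cap `a_C`
  obtain ⟨j₁, aC, εC, hj₁, haC, hεC, -, hRC⟩ := exists_regime_radii_uniform (𝒴 := 𝒴) (𝒵 := 𝒳) hb hC₂ hc₄ one_pos
  obtain ⟨j₀, a, ε₄, hj₀, ha, hε₄, hcap, hR⟩ := exists_regime_radii_uniform (𝒴 := 𝒴) (𝒵 := 𝒵) hB₀ hC₄ ha₃ haC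
  -- the Sect. C contraction number is read off ONE member of the family (the zero operator obeys every bound)
  have RC0 : Regime (0 : 𝒳 →L[ℂ] 𝒴) 0 (fun _ : 𝒴 => (0 : 𝒳)) b 0 C₂ c₄ 0 aC εC :=
    hRC 0 (fun f => by simp; positivity) ⟨fun Y _ => by simp; positivity, fun P Q => by simp⟩ 0 le_rfl hj₁.le
  have hcontr : 4 * b * C₂ * (εC + aC) < 1 := by simpa using RC0.contr
  have hden : 0 < 1 - 4 * b * C₂ * (εC + aC) := by linarith
  refine ⟨j₀, a, ε₄, aC, εC, 1 / (1 - 4 * b * C₂ * (εC + aC)) * (ε₄ + a), a / (b₁ + 1), hj₀, ha, hε₄, haC, hεC, by positivity,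
    by positivity, hcap, le_rfl, hcontr, ?_⟩
  intro 𝒢 H H₁ h𝒢 hH hH₁ W C hW hC
  refine ⟨hR 𝒢 h𝒢 hW j₀ hj₀.le le_rfl, hRC H hH hC 0 le_rfl hj₁.le, fun B hB => ?_⟩
  rw [mem_ball_zero_iff] at hB
  have h1 : ‖H₁ B‖ ≤ b₁ * ‖B‖ := hH₁ B
  have h2 : b₁ * ‖B‖ ≤ b₁ * (a / (b₁ + 1)) := mul_le_mul_of_nonneg_left hB.le hb₁
  have h3 : b₁ * (a / (b₁ + 1)) < a := by
    rw [mul_div_assoc', div_lt_iff₀ (by positivity)]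
    nlinarith
  linarith

end Two

/-! ## §3 At the NE9 letters: the Sect. C regime at `(H, Cc …)` UNIFORM over the (31)–(32)-window, given one (46)-type bound `b` -/

section NE9

open B11Eq115Space
open B11Eq44COperatorTorus (Cc prop4Hyp_Cc quadAnalytic_Cc)
open B11Eq111FrakG (nabla115)
open B9Eq319QprimeTorus (fineP)   open B9SectCLatticeCarrier (Bond)   open B4Sect5Torus (TSite)   open B7Prop1Explicit (U1 Wcx boxVec)
open B9Eq315QTorus (perCfg cornerSite)

variable {d : ℕ} {𝔸 : Type*} [NormedRing 𝔸] [NormedAlgebra ℂ 𝔸] [CompleteSpace 𝔸] [NormOneClass 𝔸] [FiniteDimensional ℂ 𝔸]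
  (L : ℕ) (m : Fin d → ℕ) [∀ i, NeZero (fineP L m i)] (η : ℝ)
  (lev₀ : Bond d (fineP L m) → ℕ) (lev₁ : Bond d (fineP L m) × Fin d → ℕ) (levB : Bond d m → ℕ) [Fact (0 < (L : ℝ))] [Fact (0 < η)]
  (hL : 1 ≤ L) {α : ℝ} (hα : α ≤ 1 / 128) (hlev : ∀ b, 1 ≤ lev₀ b)

include hL hα hlev in
/-- **THE SECT. C RADII ARE UNIFORM OVER THE (31)–(32)-WINDOW GIVEN ONE (46)-TYPE BOUND** — for EVERY background `U` with `hU1`, `hreg` (at the fixed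
`α ≤ 1∕128`) and EVERY carrier-typed `H : NegSize (L:ℝ) η levB 0 𝔸 →L[ℂ] Space115 (L:ℝ) η lev₀ lev₁ (nabla115 η U)` with `‖Hf‖ ≤ b‖f‖`:
`Regime H 0 (Cc L m η U …) b 0 (2097152(d+1)²) (1∕(512(d+1))) 0 r_C r_C` at the SAME closed-form radius
`r_C := min (c₄∕4) (min (1∕2) (1∕(16(b·C₂ + 1))))`, `C₂ = 2097152(d+1)²`, `c₄ = 1∕(512(d+1))` — i.e. `a_C = ε_C = r_C(b, d)` do NOT depend on `U` or
on `H` beyond the bound (NE9 leaf-03's `prop4Hyp_Cc` constants are already `U`-free).  Print: (46) gives `b = B₀` uniform by [5] Thm 3.12 and Prop. 3's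
threshold is a formula in `B₀, C₂`; here the bound `b` stays a LETTER. [cite: Balaban1985Variational, (46)–(47) p.285, Prop. 3 p.289, (62) p.287] -/
theorem sectC_regime_uniform {b : ℝ} (hb : 0 ≤ b) (U : Bond d (fineP L m) → 𝔸ˣ)
    (hU1 : ∀ (x : B7Prop1Explicit.Site d) (κ : Fin d), perCfg (fineP L m) U x κ ∈ U1 𝔸)
    (hreg : ∀ (y : TSite d m) (κ : Fin d) (r : Fin d → Fin L),
      ‖((Wcx L (perCfg (fineP L m) U) (cornerSite L y) κ (boxVec L r) : 𝔸ˣ) : 𝔸) - 1‖ ≤ α)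
    (H : NegSize (L : ℝ) η levB 0 𝔸 →L[ℂ] Space115 (L : ℝ) η lev₀ lev₁ (nabla115 η U)) (hH : ∀ f, ‖H f‖ ≤ b * ‖f‖) :
    Regime H 0 (Cc L m η U lev₀ lev₁ (nabla115 η U) levB) b 0 (2097152 * ((d : ℝ) + 1) ^ 2) (1 / (512 * ((d : ℝ) + 1))) 0
      (min (1 / (512 * ((d : ℝ) + 1)) / 4) (min ((1 : ℝ) / 2) (1 / (16 * (b * (2097152 * ((d : ℝ) + 1) ^ 2) + 1)))))
      (min (1 / (512 * ((d : ℝ) + 1)) / 4) (min ((1 : ℝ) / 2) (1 / (16 * (b * (2097152 * ((d : ℝ) + 1) ^ 2) + 1))))) :=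
  regime_explicit hb (by positivity) (by positivity) one_pos H hH
    (quadAnalytic_Cc L m η U lev₀ lev₁ (nabla115 η U) levB hL hα hU1 hreg hlev)
    (by have := radius_pos (a₃ := 1 / (512 * ((d : ℝ) + 1))) (C₄ := 2097152 * ((d : ℝ) + 1) ^ 2) hb (by positivity) (by positivity) one_pos
        positivity)

include hL hα hlev in
/-- The same at the operator norm `b := B` of a UNIFORM bound `‖H‖ ≤ B` (the form the owner's (H3) programme produces).
[cite: Balaban1985Variational, (46)–(47) p.285, Prop. 3 p.289] -/
theorem sectC_regime_uniform_opNorm {B : ℝ} (hB : 0 ≤ B) (U : Bond d (fineP L m) → 𝔸ˣ)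
    (hU1 : ∀ (x : B7Prop1Explicit.Site d) (κ : Fin d), perCfg (fineP L m) U x κ ∈ U1 𝔸)
    (hreg : ∀ (y : TSite d m) (κ : Fin d) (r : Fin d → Fin L),
      ‖((Wcx L (perCfg (fineP L m) U) (cornerSite L y) κ (boxVec L r) : 𝔸ˣ) : 𝔸) - 1‖ ≤ α)
    (H : NegSize (L : ℝ) η levB 0 𝔸 →L[ℂ] Space115 (L : ℝ) η lev₀ lev₁ (nabla115 η U)) (hH : ‖H‖ ≤ B) :
    Regime H 0 (Cc L m η U lev₀ lev₁ (nabla115 η U) levB) B 0 (2097152 * ((d : ℝ) + 1) ^ 2) (1 / (512 * ((d : ℝ) + 1))) 0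
      (min (1 / (512 * ((d : ℝ) + 1)) / 4) (min ((1 : ℝ) / 2) (1 / (16 * (B * (2097152 * ((d : ℝ) + 1) ^ 2) + 1)))))
      (min (1 / (512 * ((d : ℝ) + 1)) / 4) (min ((1 : ℝ) / 2) (1 / (16 * (B * (2097152 * ((d : ℝ) + 1) ^ 2) + 1))))) :=
  sectC_regime_uniform L m η lev₀ lev₁ levB hL hα hlev hB U hU1 hreg H fun f => (H.le_opNorm f).trans (mul_le_mul_of_nonneg_right hH (norm_nonneg f))

include hL hα hlev in
/-- **THE (∃ radii, ∀ U) FORM**: for every `b ≥ 0` there are `a_C, ε_C > 0` with `4bC₂(ε_C + a_C) < 1` such that for EVERY background of the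
(31)–(32)-window and EVERY carrier-typed `H` under the bound `b`, the Sect. C regime holds at `(a_C, ε_C)`. [cite: Balaban1985Variational, (46)–(47) p.285, Prop. 3 p.289] -/
theorem exists_sectC_radii_uniform {b : ℝ} (hb : 0 ≤ b) :
    ∃ aC εC : ℝ, 0 < aC ∧ 0 < εC ∧ 4 * b * (2097152 * ((d : ℝ) + 1) ^ 2) * (εC + aC) < 1 ∧
      ∀ (U : Bond d (fineP L m) → 𝔸ˣ),
        (∀ (x : B7Prop1Explicit.Site d) (κ : Fin d), perCfg (fineP L m) U x κ ∈ U1 𝔸) →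
        (∀ (y : TSite d m) (κ : Fin d) (r : Fin d → Fin L),
          ‖((Wcx L (perCfg (fineP L m) U) (cornerSite L y) κ (boxVec L r) : 𝔸ˣ) : 𝔸) - 1‖ ≤ α) →
        ∀ (H : NegSize (L : ℝ) η levB 0 𝔸 →L[ℂ] Space115 (L : ℝ) η lev₀ lev₁ (nabla115 η U)), (∀ f, ‖H f‖ ≤ b * ‖f‖) →
          Regime H 0 (Cc L m η U lev₀ lev₁ (nabla115 η U) levB) b 0 (2097152 * ((d : ℝ) + 1) ^ 2) (1 / (512 * ((d : ℝ) + 1))) 0 aC εC :=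
  ⟨_, _, radius_pos (a₃ := 1 / (512 * ((d : ℝ) + 1))) (C₄ := 2097152 * ((d : ℝ) + 1) ^ 2) (δ := 1) hb (by positivity) (by positivity) one_pos,
    radius_pos (a₃ := 1 / (512 * ((d : ℝ) + 1))) (C₄ := 2097152 * ((d : ℝ) + 1) ^ 2) (δ := 1) hb (by positivity) (by positivity) one_pos,
    radius_contr (a₃ := 1 / (512 * ((d : ℝ) + 1))) (δ := 1) hb (by positivity) (by positivity) one_pos,
    fun U hU1 hreg H hH => sectC_regime_uniform L m η lev₀ lev₁ levB hL hα hlev hb U hU1 hreg H hH⟩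

end NE9

end Literature.MathematicalPhysics.QuantumFieldTheory.Balaban1983to89.B11Eq118RegimeRadiiUniform

end
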